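import Summits.CriticalPhenomena.CardyFormulaZ2.Theorems.CardyBoundaryCoulombGasHalfPlaneMarkDensityLawSymmetry

/-!
# Reflection of the legged event (stub `legged_reflect_eq`)

Support for crux stmt-CriticalPhenomena-5661 (`HalfPlaneMarkDensityLaw`), line Sketch, Stage II
(self-duality of the half-plane arc-crossing function of bond-`ℤ²` at `p = 1/2`).
`H = {x₁ ≥ 0}`; the leg at `a` is the vertical edge `{(a,−1), (a,0)}`.  The exact identity
`P(E(S,X)) + P(D(S,X)) = 1` reads the dual legged event back as the primal legged event
`{∃ b ∈ [−S,0], b' ≥ X : legs at b, b' open, (b,0) ↔ (b',0) in H}`, while the thinning inequality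
`legs_thinning` is stated for the reflected legged event
`{∃ a ≤ −X, b ∈ [0,S] : legs at a, b open, (a,0) ↔ (b,0) in H}`.  Here we prove that the two have
the same probability: the lattice reflection `x₀ ↦ −x₀` (`reflectIso 0`) preserves `P_{1/2}`
(`bondPercolation_real_preimage_relabel_iso`), maps `H` onto `H`, the leg at `b` onto the leg at
`−b`, and `{(b,0) ↔ (b',0) in H}` onto `{(−b,0) ↔ (−b',0) in H}`.
-/

noncomputable section
namespace Summit.CriticalPhenomena.CardyFormulaZ2.Cruxes.HalfPlaneMarkDensityLaw.SketchLine.SelfDual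
open Literature.Probability.Percolation Literature.Probability.LatticeModels
open Literature.Probability.Percolation.Z2HalfPlane (leg adj_leg)
open MeasureTheory Filter Set SimpleGraph
open Summit.CriticalPhenomena.CardyFormulaZ2.Theorems.HalfPlaneMarkDensityLaw.Negative

namespace LeggedReflect

/-- The reflection `x₀ ↦ −x₀` on a point `(b, c)`: `(b, c) ↦ (−b, c)`. [folklore] -/
theorem reflect_vec (b c : ℤ) : reflectIso (d := 2) 0 (![b, c] : Site 2) = ![-b, c] := by
  funext m
  by_cases hm : m = 0
  · subst hm
    rw [reflectIso_apply_same]; rfl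
  · rw [reflectIso_apply_of_ne hm, Fin.eq_one_of_ne_zero m hm]; rfl

/-- The reflection `x₀ ↦ −x₀` is its own inverse. [folklore] -/
theorem reflect_toEquiv_symm :
    (reflectIso (d := 2) 0).toEquiv.symm = (reflectIso (d := 2) 0).toEquiv := by
  refine Equiv.ext fun v => ?_
  rw [Equiv.symm_apply_eq]
  exact (Subseq.reflect_reflect v).symm

/-- Relabelling along the reflection twice is the identity. [folklore] -/
theorem relabel_reflect_relabel_reflect (ω : BondConfig (Site 2)) :
    BondConfig.relabel (sym2Equiv (reflectIso (d := 2) 0).toEquiv)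
      (BondConfig.relabel (sym2Equiv (reflectIso (d := 2) 0).toEquiv) ω) = ω := by
  have h := relabel_symm_relabel (reflectIso (d := 2) 0).toEquiv ω
  rwa [reflect_toEquiv_symm] at h

/-- The reflection maps the leg at `b` onto the leg at `−b`:
`leg (−b) ∈ ρ '' ω ↔ leg b ∈ ω`. [folklore] -/
theorem leg_neg_mem_relabel_iff (b : ℤ) (ω : BondConfig (Site 2)) :
    leg (-b) ∈ BondConfig.relabel (sym2Equiv (reflectIso (d := 2) 0).toEquiv) ω ↔ leg b ∈ ω := by
  have h := mk_mem_relabel_iff (reflectIso (d := 2) 0).toEquiv ω ![b, -1] ![b, 0]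
  have h1 : (reflectIso (d := 2) 0).toEquiv ![b, -1] = ![-b, -1] := reflect_vec b (-1)
  have h2 : (reflectIso (d := 2) 0).toEquiv ![b, 0] = ![-b, 0] := reflect_vec b 0
  rw [h1, h2] at h
  exact h

/-- The reflection carries `{(b,0) ↔ (b',0) in H}` into `{(−b,0) ↔ (−b',0) in H}`. [folklore] -/
theorem relabel_mem_openConnIn_reflect {ω : BondConfig (Site 2)} {b b' : ℤ}
    (h : ω ∈ openConnIn halfPlane ![b, 0] ![b', 0]) :
    BondConfig.relabel (sym2Equiv (reflectIso (d := 2) 0).toEquiv) ω ∈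
      openConnIn halfPlane ![-b, 0] ![-b', 0] := by
  have h' := relabel_mem_openConnIn (reflectIso (d := 2) 0).toEquiv h
  have himg : ((reflectIso (d := 2) 0).toEquiv : Site 2 → Site 2) '' halfPlane = halfPlane :=
    Subseq.image_reflect_halfPlane
  have h1 : (reflectIso (d := 2) 0).toEquiv ![b, 0] = ![-b, 0] := reflect_vec b 0
  have h2 : (reflectIso (d := 2) 0).toEquiv ![b', 0] = ![-b', 0] := reflect_vec b' 0
  rw [himg, h1, h2] at h'
  exact h'

/-- **The reflection pulls the reflected legged event back to the legged event**:
`(ρ '' ·)⁻¹ {∃ a ≤ −X, b ∈ [0,S] : legs at a, b open, (a,0) ↔ (b,0) in H}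
 = {∃ b ∈ [−S,0], b' ≥ X : legs at b, b' open, (b,0) ↔ (b',0) in H}`. [folklore] -/
theorem preimage_relabel_reflect_legged (S X : ℤ) :
    BondConfig.relabel (sym2Equiv (reflectIso (d := 2) 0).toEquiv) ⁻¹'
        {ω : BondConfig (Site 2) | ∃ a b : ℤ, a ≤ -X ∧ 0 ≤ b ∧ b ≤ S ∧
          leg a ∈ ω ∧ leg b ∈ ω ∧ ω ∈ openConnIn halfPlane ![a, 0] ![b, 0]} =
      {ω : BondConfig (Site 2) | ∃ b b' : ℤ, -S ≤ b ∧ b ≤ 0 ∧ X ≤ b' ∧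
        leg b ∈ ω ∧ leg b' ∈ ω ∧ ω ∈ openConnIn halfPlane ![b, 0] ![b', 0]} := by
  ext ω
  simp only [Set.mem_preimage, Set.mem_setOf_eq]
  constructor
  · rintro ⟨a, b, ha, hb0, hbS, hla, hlb, hpath⟩
    refine ⟨-b, -a, by omega, by omega, by omega, ?_, ?_, ?_⟩
    · rw [← leg_neg_mem_relabel_iff, neg_neg]; exact hlb
    · rw [← leg_neg_mem_relabel_iff, neg_neg]; exact hla
    · have h2 := relabel_mem_openConnIn_reflect hpath
      rw [relabel_reflect_relabel_reflect] at h2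
      rw [openConnIn_comm]
      exact h2
  · rintro ⟨b, b', hSb, hb0, hXb', hlb, hlb', hpath⟩
    refine ⟨-b', -b, by omega, by omega, by omega, ?_, ?_, ?_⟩
    · rw [leg_neg_mem_relabel_iff]; exact hlb'
    · rw [leg_neg_mem_relabel_iff]; exact hlb
    · rw [openConnIn_comm]
      exact relabel_mem_openConnIn_reflect hpath

end LeggedReflect

/-- **Reflection of the legged event** (registered stub `legged_reflect_eq` of line Sketch):
under the lattice reflection `x₀ ↦ −x₀`, which preserves `P_{1/2}` and the half-plane `H`,
`P[∃ b ∈ [−S,0], b' ≥ X : legs at b, b' open, (b,0) ↔ (b',0) in H]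
 = P[∃ a ≤ −X, b ∈ [0,S] : legs at a, b open, (a,0) ↔ (b,0) in H]`
(`bondPercolation_real_preimage_relabel_iso (reflectIso 0)`). [folklore] -/
theorem legged_reflect_eq : ∀ (S X : ℤ), μ.real {ω : BondConfig (Site 2) | ∃ b b' : ℤ, -S ≤ b ∧ b ≤ 0 ∧ X ≤ b' ∧ leg b ∈ ω ∧ leg b' ∈ ω ∧ ω ∈ openConnIn halfPlane ![b, 0] ![b', 0]} = μ.real {ω : BondConfig (Site 2) | ∃ a b : ℤ, a ≤ -X ∧ 0 ≤ b ∧ b ≤ S ∧ leg a ∈ ω ∧ leg b ∈ ω ∧ ω ∈ openConnIn halfPlane ![a, 0] ![b, 0]} := by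
  intro S X
  rw [← LeggedReflect.preimage_relabel_reflect_legged S X]
  unfold μ
  exact bondPercolation_real_preimage_relabel_iso (reflectIso (d := 2) 0) half _

end Summit.CriticalPhenomena.CardyFormulaZ2.Cruxes.HalfPlaneMarkDensityLaw.SketchLine.SelfDual
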